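import Literature.Barriers.CriticalPhenomena.SupercriticalSAWSpaceFillingTuned
import Literature.Barriers.CriticalPhenomena.SupercriticalSAWSpaceFillingPhases
import HarnessLib

/-!
# Barrier mechanism, seventh audit: the non-filling (Problem-10) conclusion is LEFT-robust —
# subcritical walks are not weakly space-filling, the weak space-filling transition of the
# fugacity-`x` SAW of the disc sits exactly at `x_c`, and a LEFT-uniform subcritical estimate
# transfers to `x_c` by continuity in the fugacity at fixed mesh

Barrier catalogue `Literature/Barriers/CriticalPhenomena/` (D-0021); seventh audit (2026-08-16,
refuter, "barrier-audit" gen 7) of the mechanism file `…Proofs` of `SupercriticalSAWSpaceFilling`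
(= Theorem 1 of H. Duminil-Copin, G. Kozma, A. Yadin, *Supercritical self-avoiding walks are
space-filling*, Ann. IHP Probab. Stat. 50 (2014) 315–326, arXiv:1110.3074 — PROVED in the tree,
`SupercriticalSAWSpaceFilling_holds`; `blocks:` line `¬ RobustSAWScalingLimit` proved with no
hypothesis, `SupercriticalSAW.not_robustSAWScalingLimit`). Generations 1–6 settled the fugacity
axis for the conclusion "the curve-topology limit is chordal SLE_κ" on both sides of `x_c` and for
every `κ` (`…Subcritical`, `…Phases`: an SLE_κ limit of the fugacity-`x` SAW of `(𝔻; 1, -1)`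
forces `x = x_c ∨ (x_c < x ∧ 8 ≤ κ)`), proved that the mechanism is an equivalence on limit laws
(`…ProofsOnto`: weakly space-filling iff the limit is a.s. ONTO the domain), and classified the
`x`-robust conclusions NOT obstructed by Theorem 1 as RIGHT-robust (evasion (vii): conclusions
compatible with onto limits — conformal invariance / covariance, non-degeneracy, "SLE_κ for some
`κ(x)`", predicted on `[x_c, ∞)`) or TWO-SIDEDLY robust (those also true of the degenerate
subcritical limit: tightness, subsequential limits, reversibility, domain Markov; gen 6, item 5).
The catalogue text since gen 5 summarises the obstructed class as "any conclusion that would hold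
at a single fugacity `x > 0` other than the point `x_c`".

Outcome of this audit: **CONFIRMED at page level, and NARROWED on the conclusion axis by the
mirror class the catalogue does not name — the LEFT-robust conclusions.** The sentence just
quoted is correct for the SLE_κ (`κ < 8`) IDENTIFICATION only. The conclusions that Theorem 1
kills in right- or two-sidedly robust form — "not weakly space-filling", "limits not onto /
thin / supported on simple or degenerate curves", "a fixed open set off the chord is avoided with
probability `≥ p > 0`", upper bounds on the length — i.e. exactly the PROBLEM-10-type
conclusions, the `(A)/(S)`-items of `…ProofsOnto` item 2 and the one Lawler–Schramm–Werner input
that is `x_c`-specific from the right (support on simple paths [LSW04, §2.1 and Thm 1(ii)]) —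
hold at EVERY subcritical fugacity `0 < x < x_c` — proved here for non-filling at lattice level
(item 1) and for "not onto / a fixed ball is missed with positive probability" at the level of
limit laws (item 4), expected in the remaining forms (avoidance of a GIVEN set off the chord,
simplicity: the geodesic picture) — and are conjectured at `x_c` (Problem 10 of the source, open):
they are LEFT-robust, and no result of the source or of the catalogue obstructs a proof of any of
them valid on a left neighbourhood `(x_c - ε, x_c]`. Moreover such a proof need never be run AT `x_c`: a bound valid uniformly on
the open half-line below `x_c` transfers to `x_c` for free (item 3).

## What the audit found

1. **Subcritical walks are not weakly space-filling — at lattice level, with no limit theory**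
   (`not_isSpaceFillingFamily_of_lt_criticalFugacity`: `0 < x < x_c`, unit disc, ANY endpoints
   in `𝔻_δ`). The source poses non-filling only AT `x = 1/μ` ("**Problem 10.** When `x = 1/μ`
   and `(Ω,a,b)` is sufficiently regular, show that the sequence `(γ_δ)` does not become
   space-filling", arXiv p. 8) and describes the subcritical phase as the expected geodesic
   ("When `x < 1/μ`: `γ_δ` converges to a deterministic curve corresponding to the geodesic …
   we are not aware of a reference for the details", p. 2). The tree had the subcritical length
   bound `|γ_δ| ≤ C(x)/δ` w.h.p. (`tendsto_lawAt_length_lt_of_lt_criticalFugacity`,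
   `…SubcriticalLength`, from `cₙ xⁿ` summable for `x < 1/μ` [MadrasSlade1993, §1.2]) and its
   consequences for LIMITS in law (thin limits, `…Subcritical`; no onto limit, `…Phases`), but
   no statement about the printed lattice notion `IsSpaceFillingFamily` below `x_c`. The missing
   step is the trivial travelling-salesman bound (`card_sub_one_mul_le_length`: a walk of `Ω_δ`
   through `M` vertices whose mesh points are pairwise `≥ d` apart has `δ |γ| ≥ (M - 1) d`, by
   ordering the visits — `t ↦ ⌊t δ/d⌋` is injective on the visit times,
   `card_sub_one_mul_le_of_gap`) applied to the `(N+1)²` grid balls of `…Tuned` at spacing `2r`,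
   `r = 1/(4(N+1))`, `N > 4C`: a walk with `δ |γ_δ| ≤ C` misses one of them, so their miss
   probabilities sum to `≥ P[|γ_δ| ≤ C/δ] → 1` and cannot all tend to `0`
   (`not_isSpaceFillingLaws_of_short`, for ANY family of probability laws on SAWs of `𝔻_δ` with
   `|γ_δ| ≤ C/δ` w.h.p. — canonical, tuned or fugacity ensembles alike).
2. **The weak space-filling transition is located exactly at `x_c`, punctured**
   (`isSpaceFillingFamily_iff_lt_of_ne`): for boundary points `a ≠ b` of `𝔻`, closest-site
   endpoints and `x > 0`, `x ≠ x_c`, the fugacity-`x` family is weakly space-filling iff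
   `x > x_c` (Theorem 1, `DKY2014_thm1_holds`, above; item 1 below). The printed weak notion of
   §1 (p. 2) thus has exactly one undecided fugacity, `x_c` — Problem 10 — matching the source.
3. **Left transfer at fixed mesh, and Problem 10 as a purely subcritical statement (proved).**
   `x ↦ P_{(𝔻_δ,u,v,x)}(E)` is continuous on `(0, ∞)` for every event `E` at fixed mesh (a
   ratio of polynomials with positive denominator, `continuousOn_lawAt_apply`), so a lower bound
   `P_{x,δ}(E) ≥ p` valid for all `x` of a left neighbourhood `(x₀, x_c)` holds at `x_c`
   (`le_lawAt_criticalFugacity_of_left`). Consequently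
   (`not_isSpaceFillingFamily_criticalFugacity_of_leftUniform`,
   `DKY2014_problem10_disk_of_leftUniform`): **if for some non-empty open `U ⊆ 𝔻`, `p > 0`,
   `x₀ < x_c`, `δ₀ > 0` the fugacity-`x` walk avoids `U` with probability `≥ p` for all
   `δ < δ₀` and all SUBCRITICAL `x ∈ (x₀, x_c)`, then the critical family is not weakly
   space-filling** — the disc instance of Problem 10 (`DKY2014_problem10_disk`) follows from an
   estimate that lives entirely in the subcritical phase, where a finite correlation length,
   Ornstein–Zernike decay and the bridge / irreducible-bridge renewal structure are available at
   every point [MadrasSlade1993, §4.1–4.2] [BetzTaggi2019, §1]; the difficulty is relocated into UNIFORMITY as the mass gap closes (the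
   crossover regime `δ ≍ ξ(x)⁻¹`), for a test set `U` off the chord `[a, b]` (on the chord the
   subcritical walk does pass, so no uniform avoidance bound can hold there). This "approach the
   critical point from the subcritical side with uniform control" is the standard route of
   high-dimensional rigorous critical phenomena — for the SAW two-point function in `d ≥ 5` the
   lace expansion controls `Π_z` "uniformly in the closed interval `z ∈ [0, z_c]`" and the full
   subcritical-to-critical crossover is now a theorem "uniformly in `z ∈ [z_c - δ, z_c)`"
   [LiuSlade2026Crossover, §6.1 and Theorem 6.1] — and nothing in this catalogue speaks against
   it in `d = 2`: Theorem 1 concerns `x > 1/μ` only, and the subcritical mirror theorems of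
   `…Subcritical`/`…Phases` refute left-robust SLE IDENTIFICATIONS, not left-robust non-filling.
   For MONOTONE observables the transfer is vacuous — the length is stochastically increasing in
   `x` (`lawAt_setOf_lt_length_mono` of `…Tuned`), so a left-uniform tail bound for `|γ_δ|` IS the
   critical bound (`lawAt_setOf_lt_length_le_criticalFugacity`); its content is for non-monotone
   events such as avoidance of a set, for which no monotonicity in `x` is known.
4. **The robustness trichotomy (recorded for planners; prose, not a declaration).** With gens
   4–6 this completes the classification of fugacity-robust conclusions about the limit law of
   the fugacity-`x` SAW near `x_c`: RIGHT-robust (`[x_c, x_c + ε)`: conformal invariance /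
   covariance, non-degeneracy, restriction covariance — true of the weights `x^{|γ|}` at every
   `x` — "SLE_κ for some `κ(x)`"), LEFT-robust (`(x_c - ε, x_c]`: not onto / not weakly
   space-filling / simple-or-degenerate / positive avoidance off the chord / `|γ_δ|` not
   supercritical in scale), TWO-SIDED (tightness, subsequential limits, reversibility, domain
   Markov), and `x_c`-ONLY (the conjunctions, e.g. "chordal SLE_{8/3}" = right ∧ left, pinned by
   `sawScalingLimitAt_iff_of_pos`). Lawler–Schramm–Werner's characterisation ("there exists in
   fact only one family of probability measures … on simple curves that is conformally invariant
   and restriction covariant … chordal SLE_{8/3}" [LSW04, §2.1; Thm 1(ii)]) is precisely a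
   RIGHT-robust conjunct ∧ a LEFT-robust conjunct. The barrier forbids `x`-robust proofs of the
   conjunction; it does not forbid one-sided `x`-robust proofs of the conjuncts, to be intersected
   at `x_c`. Evaluated on the core lemma's own hypothesis `hmiss` of `…Proofs` ("the limit misses
   a ball `B(z, 2r)`, `B(z, r) ⊆ 𝔻`, with positive probability" — there an input about SLE_{8/3}):
   it HOLDS for every limit in law of subcritical SAW curves
   (`exists_ball_miss_of_subcritical_limit_unitDisc`, via the intrinsic form
   `exists_ball_measure_disjoint_ne_zero_of_not_ae`: not a.s. onto an open set ⇒ a fixed ball is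
   missed with positive probability), FAILS for every supercritical limit (`…ProofsNarrow`), and
   at `x_c` is the limit form of Problem 10.
5. **Confirmed (page level; literature).** DKY arXiv p. 2 (§1: the three phases; the weak sense
   of space-filling; Theorem 1 verbatim), p. 8 (§4: Problems 9–10, Conjecture 11). Forward
   citations (`lit citing`, 27 works, 2012–2026, unchanged since gen 6): none evades or
   contradicts Theorem 1 and none resolves Problem 10 (the critical-phase works bound speed —
   sub-ballisticity, arXiv:1205.0401; quantitative sub-ballisticity on the hexagonal lattice,
   arXiv:2310.17299 — not density, cf. `…Problem10`); arXiv / zbMATH searches ("self-avoiding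
   walk" with "space-filling", "supercritical", "fugacity domain", "subcritical
   Ornstein–Zernike", 2016–2026) surface only Betz–Taggi (subcritical geodesic picture) and
   Liu–Slade 2026 (item 3); broad discovery (`lit galaxy`, pdf corpus, bm25) only CFT surveys of
   dense polymers. Services degraded at audit time (local `searchd` rc 75, OpenAlex / Semantic
   Scholar HTTP 429) are recorded in the seat notes; nothing here depends on them.

## What this does NOT give (scope)

Item 1 shows that a short walk misses ONE of `(N+1)²` fixed balls, not that it avoids a GIVEN
ball off the chord with probability `→ 1` (the geodesic picture, which needs more than the length
bound and has no machine-checked proof). The left-uniform hypothesis of item 3 is not proved for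
any `U` — it is a REFORMULATION of (a quantitative form of) Problem 10 for the disc, plausibly
equivalent to it in difficulty; its value is the location of the work (subcritical phase,
uniformity in `x ↑ x_c`) rather than a reduction in strength. Fugacities `x ≤ 0` remain junk for
`lawAt`. Everything is for the unit disc (`…SubcriticalLength` is stated there); the TSP lemmas
are for arbitrary `Ω`.

## Formal content (all proved; one new closed `Prop`, `SupercriticalSAWSpaceFillingLeftRobust`)

TSP: `card_sub_one_mul_le_of_gap`, `card_sub_one_mul_le_length`,
`card_sub_one_mul_le_length_of_balls`; lattice non-filling: `gridSize_eq`,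
`not_isSpaceFillingLaws_of_short`, `not_isSpaceFillingFamily_of_lt_criticalFugacity`,
`not_isSpaceFillingFamily_of_lt_criticalFugacity_closest`, `isSpaceFillingFamily_iff_lt_of_ne`,
`not_forall_Ico_not_isSpaceFillingFamily`, `forall_Ioo_not_isSpaceFillingFamily`,
`forall_Ioc_not_isSpaceFillingFamily_iff`, `not_ae_carrier_subset_range_subcritical_unitDisc`,
`exists_ball_measure_disjoint_ne_zero_of_not_ae`, `exists_ball_miss_of_subcritical_limit_unitDisc`;
transfer: `continuousOn_lawAt_apply`, `le_lawAt_criticalFugacity_of_left`,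
`lawAt_setOf_lt_length_le_criticalFugacity`,
`not_isSpaceFillingFamily_criticalFugacity_of_leftUniform`, `DKY2014_problem10_disk_of_leftUniform`;
the closed `Prop` `SupercriticalSAWSpaceFillingLeftRobust` and `SupercriticalSAWSpaceFillingLeftRobust_holds`.

Mathlib: `SimpleGraph.Walk.mem_support_iff_exists_getVert`, `Nat.floor_add_one`,
`Nat.floor_le_floor`, `Finset.card_le_card_of_injOn`, `Finset.card_image_of_injective`,
`dist_triangle4`, `MeasureTheory.measure_univ_le_add_compl`, `MeasureTheory.measure_iUnion_fintype_le`,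
`tendsto_finsetSum`, `ContinuousOn.div`, `ENNReal.continuous_ofReal`, `nhdsWithin_Ioo_eq_nhdsLT`,
`ge_of_tendsto`, `Filter.Eventually.exists`.

## References (page-level; pages of the arXiv versions)

* H. Duminil-Copin, G. Kozma, A. Yadin, Ann. IHP Probab. Stat. 50 (2014) 315–326,
  arXiv:1110.3074: p. 2 (§1: "When `x < 1/μ` … geodesic … not aware of a reference for the
  details"; the weak sense of space-filling; Theorem 1), p. 8 (§4: Problem 10; Conjecture 11).
  [DuminilCopinKozmaYadin2014]
* G. F. Lawler, O. Schramm, W. Werner, *On the scaling limit of planar self-avoiding walk* (2004),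
  arXiv:math/0204277: p. 5, §2.1 (uniqueness of the conformally invariant restriction-covariant
  family on simple curves) and p. 6, Thm 1(ii). [LawlerSchrammWerner2004SAW]
* N. Madras, G. Slade, *The Self-Avoiding Walk* (1993), §1.2 — the subcritical input, through
  `…SubcriticalLength`; §4.1–4.2 (masses, bridges and irreducible bridges: the subcritical
  renewal structure, all dimensions). [MadrasSlade1993]
* V. Betz, L. Taggi, *Scaling limit of ballistic self-avoiding walk interacting with spatial
  random permutations*, EJP 24 (2019), arXiv:1612.07234: p. 2, §1 (the subcritical straight-line /
  Brownian-bridge picture "implicit in the works" of Chayes–Chayes and Ioffe, worked out by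
  Kovchegov). [BetzTaggi2019]
* Y. Liu, G. Slade, *Crossover from subcritical to critical decay: random walk, self-avoiding
  walk, percolation*, arXiv:2605.15545 (2026): p. 6, Theorem 1.6 (Crossover Theorem); p. 29,
  §6.1 and Theorem 6.1 ("for `z ∈ [0, z_c]` the lace expansion provides an OZ equation … control
  of `Π_z` uniformly in the closed interval `z ∈ [0, z_c]`"; conclusions "uniformly in
  `z ∈ [z_c - δ, z_c)`", `d ≥ 5`). [LiuSlade2026Crossover]
-/

noncomputable section

open MeasureTheory Filter Topology Metric Set Literature.Probability.LatticeModels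
  Literature.Probability.Percolation Literature.Probability.RandomPlanarGeometry
  Literature.Probability.RandomPlanarGeometry.SAW
open scoped ENNReal NNReal

namespace Literature.Barriers.CriticalPhenomena

namespace SupercriticalSAW

/-! ### Separated points on a walk cost length: the trivial travelling-salesman bound -/

section TSP

/-- Reals in `[0, n]` with pairwise gaps `≥ g > 0` number at most `n/g + 1`, i.e.
`(|T| - 1) g ≤ n` (the map `t ↦ ⌊t/g⌋` is injective on `T`). [folklore] -/
theorem card_sub_one_mul_le_of_gap {T : Finset ℝ} {g n : ℝ} (hg : 0 < g) (hn : 0 ≤ n)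
    (h0 : ∀ t ∈ T, 0 ≤ t) (hTn : ∀ t ∈ T, t ≤ n)
    (hgap : ∀ s ∈ T, ∀ t ∈ T, s ≠ t → g ≤ |s - t|) :
    ((T.card : ℝ) - 1) * g ≤ n := by
  set φ : ℝ → ℕ := fun t => ⌊t / g⌋₊ with hφ
  have hmaps : Set.MapsTo φ (T : Set ℝ) (Finset.range (⌊n / g⌋₊ + 1) : Set ℕ) := by
    intro t ht
    rw [Finset.coe_range, Set.mem_Iio, Nat.lt_add_one_iff]
    exact Nat.floor_le_floor (div_le_div_of_nonneg_right (hTn t ht) hg.le)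
  have key : ∀ s ∈ T, ∀ t ∈ T, s < t → φ s < φ t := by
    intro s hs t ht hst
    have hgap' : g ≤ t - s := by
      have := hgap s hs t ht hst.ne
      rwa [abs_sub_comm, abs_of_pos (sub_pos.2 hst)] at this
    have h1 : s / g + 1 ≤ t / g := by
      have h := div_le_div_of_nonneg_right (show s + g ≤ t by linarith) hg.le
      rwa [add_div, div_self hg.ne'] at h
    calc φ s < ⌊s / g⌋₊ + 1 := Nat.lt_succ_self _
      _ = ⌊s / g + 1⌋₊ := (Nat.floor_add_one (div_nonneg (h0 s hs) hg.le)).symm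
      _ ≤ φ t := Nat.floor_le_floor h1
  have hinj : Set.InjOn φ (T : Set ℝ) := by
    intro s hs t ht hφst
    by_contra hne
    rcases lt_or_gt_of_ne hne with hlt | hlt
    · exact absurd hφst (key s hs t ht hlt).ne
    · exact absurd hφst.symm (key t ht s hs hlt).ne
  have hcard := Finset.card_le_card_of_injOn φ hmaps hinj
  rw [Finset.card_range] at hcard
  have h1 : (T.card : ℝ) ≤ n / g + 1 := by
    calc (T.card : ℝ) ≤ ((⌊n / g⌋₊ + 1 : ℕ) : ℝ) := by exact_mod_cast hcard
      _ = (⌊n / g⌋₊ : ℝ) + 1 := by push_cast; ring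
      _ ≤ n / g + 1 := by
          have := Nat.floor_le (div_nonneg hn hg.le)
          linarith
  have h2 : (T.card : ℝ) - 1 ≤ n / g := by linarith
  calc ((T.card : ℝ) - 1) * g ≤ (n / g) * g := mul_le_mul_of_nonneg_right h2 hg.le
    _ = n := div_mul_cancel₀ n hg.ne'

/-- **Separated vertices on a walk of `Ω_δ` cost length.** If a walk `p` of `Ω_δ` (`δ > 0`)
passes through vertices `v i`, `i : ι`, whose mesh points are pairwise at distance `≥ d > 0`,
then `(|ι| - 1) d ≤ δ |p|`: order the vertices by their position along `p`; mesh points `m` steps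
apart along a lattice walk are at distance `≤ m δ` (`dist_meshPoint_getVert_le`). [folklore] -/
theorem card_sub_one_mul_le_length {Ω : Set ℂ} {δ : ℝ} (hδ : 0 < δ) {a b : Site 2}
    (p : (discreteDomainGraph Ω δ).Walk a b) {ι : Type*} [Fintype ι] (v : ι → Site 2)
    (hv : ∀ i, v i ∈ p.support) {d : ℝ} (hd : 0 < d)
    (hfar : ∀ i j, i ≠ j → d ≤ dist (meshPoint δ (v i)) (meshPoint δ (v j))) :
    ((Fintype.card ι : ℝ) - 1) * d ≤ δ * p.length := by
  classical
  have hpos : ∀ i, ∃ n : ℕ, p.getVert n = v i ∧ n ≤ p.length := fun i =>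
    SimpleGraph.Walk.mem_support_iff_exists_getVert.1 (hv i)
  choose t ht htle using hpos
  -- mesh distance along the walk
  have hdist : ∀ i j, t i ≤ t j →
      dist (meshPoint δ (v i)) (meshPoint δ (v j)) ≤ δ * ((t j : ℝ) - t i) := by
    intro i j hij
    have h := dist_meshPoint_getVert_le hδ.le p (t i) (t j - t i)
    rw [Nat.add_sub_cancel' hij, ht i, ht j] at h
    rwa [Nat.cast_sub hij] at h
  -- gaps between the visit times
  have hgap : ∀ i j, i ≠ j → d / δ ≤ |(t i : ℝ) - t j| := by
    intro i j hij
    rw [div_le_iff₀ hδ]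
    rcases le_total (t i) (t j) with h | h
    · have h1 := (hfar i j hij).trans (hdist i j h)
      have h2 : (t i : ℝ) ≤ t j := by exact_mod_cast h
      rw [abs_sub_comm, abs_of_nonneg (sub_nonneg.2 h2)]
      linarith
    · have h1 := (hfar j i (Ne.symm hij)).trans (hdist j i h)
      have h2 : (t j : ℝ) ≤ t i := by exact_mod_cast h
      rw [abs_of_nonneg (sub_nonneg.2 h2)]
      linarith
  -- `t` is injective
  have htinj : Function.Injective (fun i => (t i : ℝ)) := by
    intro i j hij
    by_contra hne
    have h := hgap i j hne
    have hij' : (t i : ℝ) = t j := hij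
    rw [hij', sub_self, abs_zero] at h
    exact absurd h (not_le.2 (div_pos hd hδ))
  set T : Finset ℝ := Finset.univ.image (fun i => (t i : ℝ)) with hT
  have hTcard : T.card = Fintype.card ι := by
    rw [hT, Finset.card_image_of_injective _ htinj, Finset.card_univ]
  have key := card_sub_one_mul_le_of_gap (T := T) (div_pos hd hδ) (Nat.cast_nonneg p.length)
    (fun s hs => by
      obtain ⟨i, -, rfl⟩ := Finset.mem_image.1 hs
      exact Nat.cast_nonneg _)
    (fun s hs => by
      obtain ⟨i, -, rfl⟩ := Finset.mem_image.1 hs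
      exact_mod_cast htle i)
    (fun s hs s' hs' hne => by
      obtain ⟨i, -, rfl⟩ := Finset.mem_image.1 hs
      obtain ⟨j, -, rfl⟩ := Finset.mem_image.1 hs'
      exact hgap i j (fun h => hne (by rw [h])))
  rw [hTcard] at key
  calc ((Fintype.card ι : ℝ) - 1) * d = (((Fintype.card ι : ℝ) - 1) * (d / δ)) * δ := by
        rw [mul_assoc, div_mul_cancel₀ d hδ.ne']
    _ ≤ (p.length : ℝ) * δ := mul_le_mul_of_nonneg_right key hδ.le
    _ = δ * p.length := mul_comm _ _

/-- **A SAW visiting many far-apart balls is long**: if a SAW of `Ω_δ` has a vertex with mesh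
point in each of the balls `B(z i, ρ)`, `i : ι`, whose centres are pairwise at distance
`≥ d + 2ρ` (`d > 0`), then `(|ι| - 1) d ≤ δ |γ|`. [folklore] -/
theorem card_sub_one_mul_le_length_of_balls {Ω : Set ℂ} {δ : ℝ} (hδ : 0 < δ) {a b : Site 2}
    (γ : DomainSAW Ω δ a b) {ι : Type*} [Fintype ι] (z : ι → ℂ) {ρ d : ℝ} (hd : 0 < d)
    (hsep : ∀ i j, i ≠ j → d + 2 * ρ ≤ dist (z i) (z j))
    (hvis : ∀ i, ∃ v ∈ γ.walk.support, meshPoint δ v ∈ ball (z i) ρ) :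
    ((Fintype.card ι : ℝ) - 1) * d ≤ δ * γ.length := by
  choose v hv hvz using hvis
  refine card_sub_one_mul_le_length hδ γ.walk v hv hd fun i j hij => ?_
  have h1 : dist (z i) (meshPoint δ (v i)) < ρ := by rw [dist_comm]; exact mem_ball.1 (hvz i)
  have h2 : dist (meshPoint δ (v j)) (z j) < ρ := mem_ball.1 (hvz j)
  have h3 := dist_triangle4 (z i) (meshPoint δ (v i)) (meshPoint δ (v j)) (z j)
  have h4 := hsep i j hij
  linarith

end TSP

/-! ### Short families are not weakly space-filling -/

section Short

/-- For `r = 1/(4(N+1))` the grid of `…Tuned` has `N + 1` points per row. [folklore] -/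
theorem gridSize_eq (N : ℕ) : gridSize (1 / (4 * ((N : ℝ) + 1))) = N + 1 := by
  rw [gridSize]
  have : 1 / (4 * (1 / (4 * ((N : ℝ) + 1)))) = ((N + 1 : ℕ) : ℝ) := by
    push_cast
    field_simp
  rw [this, Nat.floor_natCast]

variable {A B : ℝ → Site 2}

/-- **Short families are not weakly space-filling.** A family of probability laws `P δ` on the
SAWs of `𝔻_δ` from `A δ` to `B δ` under which the walk has at most `C/δ` steps with probability
`→ 1` (macroscopic length `≤ C`) is NOT space-filling in the weak sense of §1 of the source: a
walk of macroscopic length `≤ C` cannot visit all `(N+1)²` balls of radius `r/2` centred at the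
grid points `z_{k,l}` (spacing `2r`, `r = 1/(4(N+1))`, `N > 4C`) — that costs length
`≥ ((N+1)² - 1) r ≥ N/4 > C` — so the miss probabilities of these finitely many balls sum to at
least `P[|γ_δ| ≤ C/δ] → 1` and cannot all tend to `0`.
[cite: DuminilCopinKozmaYadin2014, §1 (When x < 1/μ) and Problem 10] -/
theorem not_isSpaceFillingLaws_of_short {P : ∀ δ : ℝ, Measure (DomainSAW unitDisk δ (A δ) (B δ))}
    (hP : ∀ᶠ δ in 𝓝[>] (0 : ℝ), IsProbabilityMeasure (P δ)) {C : ℝ}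
    (hshort : Tendsto (fun δ : ℝ => P δ {γ | C / δ < γ.length}) (𝓝[>] 0) (𝓝 0)) :
    ¬ IsSpaceFillingLaws unitDisk A B P := by
  intro hSF
  -- the grid: `N + 1` points per row, `N > 4C`, spacing `2r`, test balls of radius `r/2`
  set N : ℕ := ⌈4 * C⌉₊ + 1 with hN
  have hNC : 4 * C < N := by
    rw [hN]
    push_cast
    exact lt_of_le_of_lt (Nat.le_ceil _) (lt_add_one _)
  have hN0 : (0 : ℝ) ≤ N := Nat.cast_nonneg _
  set r : ℝ := 1 / (4 * ((N : ℝ) + 1)) with hr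
  have hr0 : 0 < r := by positivity
  have hr2 : r < 1 / 2 := by
    rw [hr, div_lt_div_iff₀ (by positivity) (by norm_num : (0 : ℝ) < 2)]
    linarith
  have hgs : gridSize r = N + 1 := gridSize_eq N
  set z : Fin (N + 1) × Fin (N + 1) → ℂ := fun i => gridCenter r i.1 i.2 with hz
  set U : Fin (N + 1) × Fin (N + 1) → Set ℂ := fun i => ball (z i) (r / 2) with hU
  have hUopen : ∀ i, IsOpen (U i) := fun i => isOpen_ball
  have hUsub : ∀ i, U i ⊆ unitDisk := fun i =>
    (ball_subset_ball (by linarith)).trans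
      (ball_gridCenter_subset hr0 hr2 (by rw [hgs]; exact i.1.isLt) (by rw [hgs]; exact i.2.isLt))
  have hUne : ∀ i, (U i).Nonempty := fun i => ⟨z i, mem_ball_self (by positivity)⟩
  -- separation of the centres: `2r = r + 2 (r/2)`
  have hsep : ∀ i j, i ≠ j → r + 2 * (r / 2) ≤ dist (z i) (z j) := by
    intro i j hij
    have hne : ((i.1 : ℕ), (i.2 : ℕ)) ≠ ((j.1 : ℕ), (j.2 : ℕ)) := by
      intro h
      simp only [Prod.mk.injEq] at h
      exact hij (Prod.ext (Fin.ext h.1) (Fin.ext h.2))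
    have := two_mul_le_norm_gridCenter_sub hr0 hne
    rw [dist_eq_norm]
    linarith
  -- under space-filling, every test ball is missed with probability `→ 0`, hence so is the sum
  have hsum : Tendsto (fun δ : ℝ => ∑ i, P δ {γ | ∀ v ∈ γ.walk.support, meshPoint δ v ∉ U i})
      (𝓝[>] 0) (𝓝 0) := by
    have h := tendsto_finsetSum (Finset.univ : Finset (Fin (N + 1) × Fin (N + 1)))
      (fun i _ => hSF (U i) (hUopen i) (hUsub i) (hUne i))
    rwa [Finset.sum_const_zero] at h
  -- a short walk misses one of the test balls
  have hincl : ∀ δ : ℝ, 0 < δ →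
      {γ : DomainSAW unitDisk δ (A δ) (B δ) | C / δ < γ.length}ᶜ ⊆
        ⋃ i, {γ | ∀ v ∈ γ.walk.support, meshPoint δ v ∉ U i} := by
    intro δ hδ γ hγ
    rw [mem_compl_iff, mem_setOf_eq, not_lt] at hγ
    by_contra hmiss
    simp only [mem_iUnion, mem_setOf_eq, not_exists, not_forall, not_not] at hmiss
    have hvis : ∀ i, ∃ v ∈ γ.walk.support, meshPoint δ v ∈ ball (z i) (r / 2) := fun i => by
      obtain ⟨v, hv, hvU⟩ := hmiss i
      exact ⟨v, hv, hvU⟩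
    have key := card_sub_one_mul_le_length_of_balls hδ γ z hr0 hsep hvis
    rw [Fintype.card_prod, Fintype.card_fin] at key
    -- `((N+1)² - 1) r = N (N+2) / (4 (N+1)) ≥ N/4 > C`
    have hNr : (N : ℝ) / 4 ≤ ((((N + 1) * (N + 1) : ℕ) : ℝ) - 1) * r := by
      have h1 : ((((N + 1) * (N + 1) : ℕ) : ℝ) - 1) * r = (N : ℝ) * (N + 2) / (4 * (N + 1)) := by
        rw [hr]
        push_cast
        field_simp
        ring
      rw [h1, div_le_div_iff₀ (by norm_num) (by positivity)]
      nlinarith [hN0]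
    have hlen : δ * (γ.length : ℝ) ≤ C := by
      have := hγ
      rwa [le_div_iff₀ hδ, mul_comm] at this
    linarith
  -- measure bound: for `δ > 0` with `P δ` a probability measure,
  -- `1 ≤ P δ {C/δ < |γ|} + Σ_i P δ (miss U i)`
  have hge : ∀ᶠ δ in 𝓝[>] (0 : ℝ),
      (1 : ℝ≥0∞) ≤ P δ {γ | C / δ < γ.length} +
        ∑ i, P δ {γ | ∀ v ∈ γ.walk.support, meshPoint δ v ∉ U i} := by
    filter_upwards [hP, self_mem_nhdsWithin] with δ hPδ hδ
    haveI := hPδ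
    calc (1 : ℝ≥0∞) = P δ univ := measure_univ.symm
      _ ≤ P δ {γ | C / δ < γ.length} + P δ {γ | C / δ < γ.length}ᶜ := measure_univ_le_add_compl _
      _ ≤ P δ {γ | C / δ < γ.length} +
            P δ (⋃ i, {γ | ∀ v ∈ γ.walk.support, meshPoint δ v ∉ U i}) :=
          add_le_add le_rfl (measure_mono (hincl δ hδ))
      _ ≤ _ := add_le_add le_rfl (measure_iUnion_fintype_le _ _)
  have hlim : Tendsto (fun δ : ℝ => P δ {γ | C / δ < γ.length} +
      ∑ i, P δ {γ | ∀ v ∈ γ.walk.support, meshPoint δ v ∉ U i}) (𝓝[>] 0) (𝓝 0) := by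
    simpa using hshort.add hsum
  have hlt : ∀ᶠ δ in 𝓝[>] (0 : ℝ), P δ {γ | C / δ < γ.length} +
      ∑ i, P δ {γ | ∀ v ∈ γ.walk.support, meshPoint δ v ∉ U i} < 1 :=
    hlim.eventually (Iio_mem_nhds zero_lt_one)
  obtain ⟨δ, h1, h2⟩ := (hge.and hlt).exists
  exact absurd (h1.trans_lt h2) (lt_irrefl _)

/-- **Subcritical self-avoiding walks are not weakly space-filling** — the conclusion that
Problem 10 of the source asks for AT `x = 1/μ` holds at every fugacity `0 < x < 1/μ`, for every
choice of endpoints in `𝔻_δ`: the subcritical walk has `≤ C(x)/δ` steps with probability `→ 1`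
(`tendsto_lawAt_length_lt_of_lt_criticalFugacity`, [cite: MadrasSlade1993, §1.2]) and short
families are not weakly space-filling (`not_isSpaceFillingLaws_of_short`).
[cite: DuminilCopinKozmaYadin2014, §1 (When x < 1/μ) and Problem 10] -/
theorem not_isSpaceFillingFamily_of_lt_criticalFugacity {x : ℝ} (hx0 : 0 < x)
    (hxc : x < criticalFugacity)
    (hAB : ∀ δ : ℝ, 0 < δ → A δ ∈ meshDomain unitDisk δ ∧ B δ ∈ meshDomain unitDisk δ) :
    ¬ IsSpaceFillingFamily x unitDisk A B := by
  obtain ⟨C, -, hT⟩ := tendsto_lawAt_length_lt_of_lt_criticalFugacity hx0 hxc hAB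
  rw [← isSpaceFillingLaws_lawAt_iff]
  refine not_isSpaceFillingLaws_of_short ?_ hT
  filter_upwards [self_mem_nhdsWithin] with δ hδ
  exact isProbabilityMeasure_lawAt hδ (hAB δ hδ).1 (hAB δ hδ).2 hx0

/-- The same in the closest-site setting of Theorem 1 / Problem 10 of the source: for boundary
points `a, b` of `𝔻`, closest-site endpoints and `0 < x < 1/μ`, the fugacity-`x` family is not
weakly space-filling — `DKY2014_problem10_disk` with `x_c` replaced by any subcritical fugacity
is a theorem. [cite: DuminilCopinKozmaYadin2014, Problem 10] -/
theorem not_isSpaceFillingFamily_of_lt_criticalFugacity_closest {x : ℝ} (hx0 : 0 < x)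
    (hxc : x < criticalFugacity) {a b : ℂ}
    (hAB : ∀ δ : ℝ, 0 < δ → IsClosestSite unitDisk δ a (A δ) ∧ IsClosestSite unitDisk δ b (B δ)) :
    ¬ IsSpaceFillingFamily x unitDisk A B :=
  not_isSpaceFillingFamily_of_lt_criticalFugacity hx0 hxc fun δ hδ => ⟨(hAB δ hδ).1.1, (hAB δ hδ).2.1⟩

/-- **The weak space-filling transition of the fugacity-`x` SAW of the disc sits exactly at
`x_c`, punctured**: for boundary points `a ≠ b`, closest-site endpoints and `x > 0`, `x ≠ x_c`,
the family is weakly space-filling iff `x > x_c` (Theorem 1 of the source above `x_c`,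
`DKY2014_thm1_holds` and `isSpaceFillingFamily_of_DKY2014_thm1`; short walks below). The only
fugacity left undecided is `x_c` itself — Problem 10. [cite: DuminilCopinKozmaYadin2014, Theorem 1 and Problem 10] -/
theorem isSpaceFillingFamily_iff_lt_of_ne {x : ℝ} (hx0 : 0 < x) (hne : x ≠ criticalFugacity)
    {a b : ℂ} (ha : ‖a‖ = 1) (hb : ‖b‖ = 1) (hab : a ≠ b)
    (hAB : ∀ δ : ℝ, 0 < δ → IsClosestSite unitDisk δ a (A δ) ∧ IsClosestSite unitDisk δ b (B δ)) :
    IsSpaceFillingFamily x unitDisk A B ↔ criticalFugacity < x := by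
  refine ⟨fun h => ?_, fun h => isSpaceFillingFamily_of_DKY2014_thm1 DKY2014_thm1_holds ha hb hab hAB h⟩
  by_contra hle
  rcases lt_or_eq_of_le (not_lt.1 hle) with hlt | heq
  · exact not_isSpaceFillingFamily_of_lt_criticalFugacity_closest hx0 hlt hAB h
  · exact hne heq

/-- **Right classes of the non-filling conclusion are refuted**: for every `ε > 0` it is false
that the fugacity-`x` family (closest-site endpoints of boundary points `a ≠ b`) fails to be
weakly space-filling for all `x ∈ [x_c, x_c + ε)` — at `x_c + ε/2` it IS (Theorem 1). This is
the half of the axis on which Theorem 1 bites. [cite: DuminilCopinKozmaYadin2014, Theorem 1] -/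
theorem not_forall_Ico_not_isSpaceFillingFamily {a b : ℂ} (ha : ‖a‖ = 1) (hb : ‖b‖ = 1)
    (hab : a ≠ b)
    (hAB : ∀ δ : ℝ, 0 < δ → IsClosestSite unitDisk δ a (A δ) ∧ IsClosestSite unitDisk δ b (B δ))
    {ε : ℝ} (hε : 0 < ε) :
    ¬ ∀ x ∈ Ico criticalFugacity (criticalFugacity + ε), ¬ IsSpaceFillingFamily x unitDisk A B :=
  fun h => h (criticalFugacity + ε / 2) ⟨by linarith, by linarith⟩
    (isSpaceFillingFamily_of_DKY2014_thm1 DKY2014_thm1_holds ha hb hab hAB (by linarith))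

/-- **Left-open classes of the non-filling conclusion are theorems**: for every `ε`, the
fugacity-`x` family is not weakly space-filling for all `x ∈ (x_c - ε, x_c)`, `x > 0` (any
endpoints in `𝔻_δ`). [cite: DuminilCopinKozmaYadin2014, §1 (When x < 1/μ) and Problem 10] -/
theorem forall_Ioo_not_isSpaceFillingFamily
    (hAB : ∀ δ : ℝ, 0 < δ → A δ ∈ meshDomain unitDisk δ ∧ B δ ∈ meshDomain unitDisk δ) (ε : ℝ) :
    ∀ x ∈ Ioo (criticalFugacity - ε) criticalFugacity, 0 < x →
      ¬ IsSpaceFillingFamily x unitDisk A B :=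
  fun _ hx hx0 => not_isSpaceFillingFamily_of_lt_criticalFugacity hx0 hx.2 hAB

/-- **The left-closed class is exactly Problem 10**: for `ε > 0`, "not weakly space-filling for
all `x ∈ (x_c - ε, x_c]`, `x > 0`" is EQUIVALENT to the single statement at `x_c` — the left
neighbourhood adds nothing to be proved and nothing that could be refuted.
[cite: DuminilCopinKozmaYadin2014, Problem 10] -/
theorem forall_Ioc_not_isSpaceFillingFamily_iff
    (hAB : ∀ δ : ℝ, 0 < δ → A δ ∈ meshDomain unitDisk δ ∧ B δ ∈ meshDomain unitDisk δ) {ε : ℝ}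
    (hε : 0 < ε) :
    (∀ x ∈ Ioc (criticalFugacity - ε) criticalFugacity, 0 < x →
        ¬ IsSpaceFillingFamily x unitDisk A B) ↔
      ¬ IsSpaceFillingFamily criticalFugacity unitDisk A B := by
  refine ⟨fun h => h criticalFugacity ⟨by linarith, le_rfl⟩ criticalFugacity_pos, fun h x hx hx0 => ?_⟩
  rcases lt_or_eq_of_le hx.2 with hlt | heq
  · exact not_isSpaceFillingFamily_of_lt_criticalFugacity hx0 hlt hAB
  · rw [heq]; exact h

/-- **Limit-law form of the left side** (the `(A)`-item "limits are not onto" at every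
subcritical fugacity): for `0 < x < x_c` and any endpoints in `𝔻_δ`, no limit in law of the
fugacity-`x` SAW curves of `(𝔻; 1, -1)` — any random curve class `Γ` on any non-zero finite
measure space, along `δ → 0⁺` — is almost surely onto `𝔻` (`not_ae_carrier_subset_range_of_short`
of `…Phases` with the subcritical length bound). Together with
`ae_carrier_subset_range_of_tendstoLaw`-type results of `…ProofsNarrow` for `x > x_c` (limits ARE
onto) this is the limit-law counterpart of `isSpaceFillingFamily_iff_lt_of_ne`.
[cite: DuminilCopinKozmaYadin2014, §1 (When x < 1/μ)] -/
theorem not_ae_carrier_subset_range_subcritical_unitDisc {x : ℝ} (hx0 : 0 < x)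
    (hxc : x < criticalFugacity)
    (hAB : ∀ δ : ℝ, 0 < δ → A δ ∈ meshDomain unitDisk δ ∧ B δ ∈ meshDomain unitDisk δ)
    {Ω' : Type*} [MeasurableSpace Ω'] {W : Measure Ω'} [IsFiniteMeasure W] (hW : W ≠ 0)
    {Γ : Ω' → CurveClass ℂ} (hΓ : AEMeasurable Γ W)
    (hT : TendstoLaw (fun δ (γ : DomainSAW DobrushinDomain.unitDisc.carrier δ (A δ) (B δ)) => γ.curve)
      (fun δ => lawAt x DobrushinDomain.unitDisc.carrier δ (A δ) (B δ)) Γ W) :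
    ¬ ∀ᵐ ω ∂W, DobrushinDomain.unitDisc.carrier ⊆ (Γ ω).range := by
  obtain ⟨C, hC, hshort⟩ := tendsto_lawAt_length_lt_of_lt_criticalFugacity hx0 hxc hAB
  exact @not_ae_carrier_subset_range_of_short DobrushinDomain.unitDisc A B
    (fun δ => lawAt x unitDisk δ (A δ) (B δ)) (fun δ => isFiniteMeasure_lawAt x unitDisk δ (A δ) (B δ))
    Ω' _ W _ hW Γ hΓ hT C hC.le hshort

/-- **A random curve that is not almost surely onto an open set misses a fixed ball of it with
positive probability** — the hypothesis `hmiss` of the core lemma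
`IsSpaceFillingFamily.not_convergesInLawToSLE` of `…Proofs` in intrinsic form: if
`¬ (a.s. D ⊆ trace Γ)` for an open `D`, then for some ball `B(z, r) ⊆ D`,
`W[trace Γ ∩ B(z, 2r) = ∅] ≠ 0` (traces are compact, hence closed; countable basis of balls with
centres in a countable dense set; a countable union of null events is null). No measurability of
`Γ` is needed. [folklore] -/
theorem exists_ball_measure_disjoint_ne_zero_of_not_ae {Ω' : Type*} [MeasurableSpace Ω']
    {W : Measure Ω'} {Γ : Ω' → CurveClass ℂ} {D : Set ℂ} (hD : IsOpen D)
    (h : ¬ ∀ᵐ ω ∂W, D ⊆ (Γ ω).range) :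
    ∃ z : ℂ, ∃ r : ℝ, 0 < r ∧ ball z r ⊆ D ∧
      W {ω | Disjoint (ball z (2 * r)) (Γ ω).range} ≠ 0 := by
  obtain ⟨S, hSc, hSd⟩ := TopologicalSpace.exists_countable_dense ℂ
  by_contra hcon
  push Not at hcon
  apply h
  -- every bad `ω` lies in a countable union of null events
  set E : ℂ → ℕ → Set Ω' := fun q n =>
    {ω | ball q (2 * (1 / ((n : ℝ) + 1))) ⊆ D ∧
      Disjoint (ball q (2 * (1 / ((n : ℝ) + 1)))) (Γ ω).range} with hE
  have hnull : W (⋃ q ∈ S, ⋃ n : ℕ, E q n) = 0 := by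
    refine (measure_biUnion_null_iff hSc).2 fun q _ => measure_iUnion_null_iff.2 fun n => ?_
    by_cases hq : ball q (2 * (1 / ((n : ℝ) + 1))) ⊆ D
    · have h0 := hcon q (1 / ((n : ℝ) + 1)) (by positivity)
        ((ball_subset_ball (by linarith [show (0 : ℝ) < 1 / ((n : ℝ) + 1) by positivity])).trans hq)
      exact measure_mono_null (fun ω hω => hω.2) h0
    · have : E q n = ∅ := by
        ext ω
        simp only [hE, mem_setOf_eq, mem_empty_iff_false, iff_false, not_and]
        exact fun h' => absurd h' hq
      rw [this, measure_empty]
  rw [ae_iff]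
  refine measure_mono_null (fun ω hω => ?_) hnull
  have hω' : ¬ D ⊆ (Γ ω).range := hω
  obtain ⟨z, hzD, hz⟩ := not_subset.1 hω'
  -- a small ball around `z` inside `D` and off the (closed) trace
  obtain ⟨ε₁, hε₁, hball₁⟩ := Metric.isOpen_iff.1 hD z hzD
  have hopen : IsOpen ((Γ ω).rangeᶜ) := (Γ ω).isCompact_range.isClosed.isOpen_compl
  obtain ⟨ε₂, hε₂, hball₂⟩ := Metric.isOpen_iff.1 hopen z hz
  obtain ⟨n, hn⟩ := exists_nat_one_div_lt (show 0 < min ε₁ ε₂ / 4 by positivity)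
  set ρ : ℝ := 1 / ((n : ℝ) + 1) with hρ
  have hρ0 : 0 < ρ := by positivity
  obtain ⟨q, hqS, hqz⟩ := hSd.exists_dist_lt z hρ0
  have hsub : ball q (2 * ρ) ⊆ ball z (min ε₁ ε₂) := by
    intro w hw
    rw [mem_ball] at hw ⊢
    have := dist_triangle w q z
    have h4 : 4 * ρ < min ε₁ ε₂ := by
      have : ρ < min ε₁ ε₂ / 4 := hn
      linarith
    rw [dist_comm z q] at hqz
    linarith
  refine mem_iUnion₂.2 ⟨q, hqS, mem_iUnion.2 ⟨n, ?_, ?_⟩⟩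
  · exact hsub.trans ((ball_subset_ball (min_le_left _ _)).trans hball₁)
  · exact Set.disjoint_left.2 fun w hw hw' =>
      (hsub.trans ((ball_subset_ball (min_le_right _ _)).trans hball₂)) hw hw'

/-- **Every limit in law of subcritical SAW curves misses a fixed ball with positive
probability.** The hypothesis `hmiss` of the core lemma of `…Proofs` — there an INPUT about
chordal SLE_{8/3} — holds for EVERY limit in law `Γ` of the fugacity-`x` SAW curves of
`(𝔻; 1, -1)` at `0 < x < x_c` (any endpoints in `𝔻_δ`, any non-zero finite `W`):
`∃ B(z, r) ⊆ 𝔻, W[trace Γ ∩ B(z, 2r) = ∅] ≠ 0`. It FAILS for every limit of supercritical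
curves (limits are onto, `ae_subset_range_of_tendstoLaw` of `…ProofsNarrow`), and at `x_c` it
is the limit form of Problem 10 — the left / right / `x_c` trichotomy evaluated on the core
lemma's own hypothesis. [cite: DuminilCopinKozmaYadin2014, §1 (When x < 1/μ) and Problem 10] -/
theorem exists_ball_miss_of_subcritical_limit_unitDisc {x : ℝ} (hx0 : 0 < x)
    (hxc : x < criticalFugacity)
    (hAB : ∀ δ : ℝ, 0 < δ → A δ ∈ meshDomain unitDisk δ ∧ B δ ∈ meshDomain unitDisk δ)
    {Ω' : Type*} [MeasurableSpace Ω'] {W : Measure Ω'} [IsFiniteMeasure W] (hW : W ≠ 0)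
    {Γ : Ω' → CurveClass ℂ} (hΓ : AEMeasurable Γ W)
    (hT : TendstoLaw (fun δ (γ : DomainSAW DobrushinDomain.unitDisc.carrier δ (A δ) (B δ)) => γ.curve)
      (fun δ => lawAt x DobrushinDomain.unitDisc.carrier δ (A δ) (B δ)) Γ W) :
    ∃ z : ℂ, ∃ r : ℝ, 0 < r ∧ ball z r ⊆ unitDisk ∧
      W {ω | Disjoint (ball z (2 * r)) (Γ ω).range} ≠ 0 :=
  exists_ball_measure_disjoint_ne_zero_of_not_ae (D := unitDisk)
    (by unfold unitDisk; exact isOpen_ball)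
    (not_ae_carrier_subset_range_subcritical_unitDisc hx0 hxc hAB hW hΓ hT)

end Short

/-! ### Transfer to `x_c` from the left: continuity in the fugacity at fixed mesh -/

section Transfer

variable {δ : ℝ} {u v : Site 2}

/-- **The law of a fixed event is continuous in the fugacity** (at fixed mesh `δ > 0`, endpoints
in `𝔻_δ`): `x ↦ P_{(𝔻_δ,u,v,x)}(E) = Σ_{γ ∈ E} x^{|γ|} / Σ_γ x^{|γ|}` is continuous on `(0, ∞)`,
a ratio of polynomials with positive denominator.
[cite: DuminilCopinKozmaYadin2014, §1 (definition of P_{(Ω_δ,a_δ,b_δ,x)})] -/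
theorem continuousOn_lawAt_apply (hδ : 0 < δ) (hu : u ∈ meshDomain unitDisk δ)
    (hv : v ∈ meshDomain unitDisk δ) (E : Set (DomainSAW unitDisk δ u v)) :
    ContinuousOn (fun x : ℝ => lawAt x unitDisk δ u v E) (Ioi 0) := by
  classical
  haveI := finite_domainSAW (v := v) hδ hu
  haveI : Fintype (DomainSAW unitDisk δ u v) := Fintype.ofFinite _
  set num : ℝ → ℝ := fun z => ∑ γ ∈ Finset.univ.filter (· ∈ E), z ^ γ.length with hnum
  set den : ℝ → ℝ := fun z => ∑ γ : DomainSAW unitDisk δ u v, z ^ γ.length with hden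
  have hcont : ContinuousOn (fun z => num z / den z) (Ioi 0) := by
    have hn : Continuous num := by
      rw [hnum]
      exact continuous_finsetSum _ fun γ _ => continuous_pow _
    have hd : Continuous den := by
      rw [hden]
      exact continuous_finsetSum _ fun γ _ => continuous_pow _
    exact hn.continuousOn.div hd.continuousOn fun z hz => (sum_pow_length_pos hδ hu hv hz).ne'
  refine (ENNReal.continuous_ofReal.comp_continuousOn hcont).congr fun z hz => ?_
  exact lawAt_apply_eq_ofReal_div hδ hu hv hz E

/-- **Left transfer at fixed mesh.** A lower bound for the probability of a fixed event valid at
every fugacity of a left neighbourhood `(x₀, x_c)` of `x_c` holds at `x_c` (continuity in `x`,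
`continuousOn_lawAt_apply`; the left filter at `x_c > 0` is non-trivial). [folklore] -/
theorem le_lawAt_criticalFugacity_of_left (hδ : 0 < δ) (hu : u ∈ meshDomain unitDisk δ)
    (hv : v ∈ meshDomain unitDisk δ) (E : Set (DomainSAW unitDisk δ u v)) {p : ℝ≥0∞} {x₀ : ℝ}
    (hx₀ : x₀ < criticalFugacity) (h : ∀ x ∈ Ioo x₀ criticalFugacity, p ≤ lawAt x unitDisk δ u v E) :
    p ≤ lawAt criticalFugacity unitDisk δ u v E := by
  set x₁ : ℝ := max x₀ (criticalFugacity / 2) with hx₁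
  have hxc := criticalFugacity_pos
  have hx₁c : x₁ < criticalFugacity := max_lt hx₀ (by linarith)
  have hcont := continuousOn_lawAt_apply hδ hu hv E
  have hT : Tendsto (fun x : ℝ => lawAt x unitDisk δ u v E)
      (𝓝[Ioo x₁ criticalFugacity] criticalFugacity) (𝓝 (lawAt criticalFugacity unitDisk δ u v E)) :=
    (hcont.continuousAt (Ioi_mem_nhds hxc)).continuousWithinAt
  haveI : (𝓝[Ioo x₁ criticalFugacity] criticalFugacity).NeBot := by
    rw [nhdsWithin_Ioo_eq_nhdsLT hx₁c]
    infer_instance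
  refine ge_of_tendsto hT ?_
  filter_upwards [self_mem_nhdsWithin] with x hx
  exact h x ⟨(le_max_left _ _).trans_lt hx.1, hx.2⟩

/-- For LENGTH events a left-uniform bound is nothing more than the critical bound: the length is
stochastically increasing in the fugacity (`lawAt_setOf_lt_length_mono` of `…Tuned`), so
`P_x[|γ| > L] ≤ P_{x_c}[|γ| > L]` for all `0 < x ≤ x_c` — the transfer principle gains (and
loses) nothing on monotone observables; its content is for non-monotone events such as the
avoidance of a set. [cite: DuminilCopinKozmaYadin2014, §1 (definition of P_{(Ω_δ,a_δ,b_δ,x)})] -/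
theorem lawAt_setOf_lt_length_le_criticalFugacity (hδ : 0 < δ) (hu : u ∈ meshDomain unitDisk δ)
    (hv : v ∈ meshDomain unitDisk δ) {x : ℝ} (hx0 : 0 < x) (hxc : x ≤ criticalFugacity) (L : ℝ) :
    lawAt x unitDisk δ u v {γ | L < γ.length} ≤
      lawAt criticalFugacity unitDisk δ u v {γ | L < γ.length} :=
  lawAt_setOf_lt_length_mono hδ hu hv hx0 hxc L

variable {A B : ℝ → Site 2}

/-- **A LEFT-uniform non-filling estimate settles the critical case.** If for some non-empty open
`U ⊆ 𝔻`, some `p > 0` and all meshes `δ < δ₀`, the fugacity-`x` walk of the disc avoids `U`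
with probability `≥ p` for EVERY subcritical `x ∈ (x₀, x_c)`, then the CRITICAL family is not
weakly space-filling (`le_lawAt_criticalFugacity_of_left` at each mesh): the Problem-10
conclusion transfers from the open subcritical half-line to `x_c` by continuity in the fugacity
at fixed mesh, no supercritical fugacity being involved.
[cite: DuminilCopinKozmaYadin2014, Problem 10] -/
theorem not_isSpaceFillingFamily_criticalFugacity_of_leftUniform
    (hAB : ∀ δ : ℝ, 0 < δ → A δ ∈ meshDomain unitDisk δ ∧ B δ ∈ meshDomain unitDisk δ)
    {U : Set ℂ} (hU : IsOpen U) (hUΩ : U ⊆ unitDisk) (hUne : U.Nonempty)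
    {p : ℝ≥0∞} (hp : p ≠ 0) {x₀ δ₀ : ℝ} (hx₀ : x₀ < criticalFugacity) (hδ₀ : 0 < δ₀)
    (h : ∀ δ ∈ Ioo 0 δ₀, ∀ x ∈ Ioo x₀ criticalFugacity,
      p ≤ lawAt x unitDisk δ (A δ) (B δ) {γ | ∀ v ∈ γ.walk.support, meshPoint δ v ∉ U}) :
    ¬ IsSpaceFillingFamily criticalFugacity unitDisk A B := by
  intro hSF
  have hT := hSF U hU hUΩ hUne
  have hlt : ∀ᶠ δ in 𝓝[>] (0 : ℝ),
      lawAt criticalFugacity unitDisk δ (A δ) (B δ) {γ | ∀ v ∈ γ.walk.support, meshPoint δ v ∉ U}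
        < p :=
    hT.eventually (Iio_mem_nhds (pos_iff_ne_zero.2 hp))
  have hge : ∀ᶠ δ in 𝓝[>] (0 : ℝ),
      p ≤ lawAt criticalFugacity unitDisk δ (A δ) (B δ)
        {γ | ∀ v ∈ γ.walk.support, meshPoint δ v ∉ U} := by
    filter_upwards [Ioo_mem_nhdsGT hδ₀] with δ hδ
    exact le_lawAt_criticalFugacity_of_left hδ.1 (hAB δ hδ.1).1 (hAB δ hδ.1).2 _ hx₀ (h δ hδ)
  obtain ⟨δ, h1, h2⟩ := (hge.and hlt).exists
  exact absurd (h1.trans_lt h2) (lt_irrefl _)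

/-- **Problem 10 for the disc reduces to a LEFT-uniform (purely subcritical) estimate**: if for
all boundary points `a ≠ b` and closest-site endpoints there are a non-empty open `U ⊆ 𝔻`,
`p > 0`, `x₀ < x_c` and `δ₀ > 0` with `P_{(𝔻_δ,a_δ,b_δ,x)}[γ_δ ∩ U = ∅] ≥ p` for all
`δ < δ₀` and all `x ∈ (x₀, x_c)`, then `DKY2014_problem10_disk` holds.
[cite: DuminilCopinKozmaYadin2014, Problem 10] -/
theorem DKY2014_problem10_disk_of_leftUniform
    (h : ∀ a b : ℂ, ‖a‖ = 1 → ‖b‖ = 1 → a ≠ b → ∀ A B : ℝ → Site 2,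
      (∀ δ : ℝ, 0 < δ → IsClosestSite unitDisk δ a (A δ) ∧ IsClosestSite unitDisk δ b (B δ)) →
        ∃ U : Set ℂ, IsOpen U ∧ U ⊆ unitDisk ∧ U.Nonempty ∧ ∃ p : ℝ≥0∞, p ≠ 0 ∧
          ∃ x₀ : ℝ, x₀ < criticalFugacity ∧ ∃ δ₀ : ℝ, 0 < δ₀ ∧
            ∀ δ ∈ Ioo 0 δ₀, ∀ x ∈ Ioo x₀ criticalFugacity,
              p ≤ lawAt x unitDisk δ (A δ) (B δ) {γ | ∀ v ∈ γ.walk.support, meshPoint δ v ∉ U}) :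
    DKY2014_problem10_disk := by
  intro a b ha hb hab A B hAB
  obtain ⟨U, hU, hUΩ, hUne, p, hp, x₀, hx₀, δ₀, hδ₀, hbound⟩ := h a b ha hb hab A B hAB
  exact not_isSpaceFillingFamily_criticalFugacity_of_leftUniform
    (fun δ hδ => ⟨(hAB δ hδ).1.1, (hAB δ hδ).2.1⟩) hU hUΩ hUne hp hx₀ hδ₀ hbound

end Transfer

end SupercriticalSAW

open SupercriticalSAW

/-! ### The audited barrier (seventh audit): the left side of the non-filling axis -/

/-- **Barrier `SupercriticalSAWSpaceFillingLeftRobust`** (seventh audit of the mechanism of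
`SupercriticalSAWSpaceFilling`; PROVED below, `SupercriticalSAWSpaceFillingLeftRobust_holds`):
Theorem 1 of Duminil-Copin–Kozma–Yadin together with (a) the LEFT side of the weak space-filling
axis at lattice level — for `0 < x < x_c`, boundary points `a, b` of `𝔻` and closest-site
endpoints, the fugacity-`x` family is NOT weakly space-filling (the conclusion of Problem 10 at
every subcritical fugacity) — and (b) the left transfer principle — a LEFT-uniform subcritical
avoidance bound (`P_{(𝔻_δ,a_δ,b_δ,x)}[γ_δ ∩ U = ∅] ≥ p > 0` for all `δ < δ₀` and all
`x ∈ (x₀, x_c)`, some non-empty open `U ⊆ 𝔻`) implies the disc instance of Problem 10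
(`DKY2014_problem10_disk`).

BARRIER (structured block, D-0021):
- technique_class: that of `SupercriticalSAWSpaceFilling` (fugacity-robust, δ-uniform CONCLUSIONS about the fugacity-`x` SAW near `x_c`), with the obstructed conclusions delimited on the LEFT: Theorem 1 [cite: DuminilCopinKozmaYadin2014, Theorem 1] obstructs a conclusion in `x`-robust form only if that form contains fugacities `x > x_c` (right-closed `[x_c, x_c + ε)` or two-sided classes) AND the conclusion fails for every law carried by curves onto the domain (`…ProofsOnto`); the catalogue sentence "any conclusion that would hold at a single fugacity `x > 0` other than the point `x_c`" (gen 5) is to be read for the SLE_κ (`κ < 8`) IDENTIFICATION only — LEFT classes `(x_c - ε, x_c]` of PROBLEM-10-TYPE conclusions (not weakly space-filling; limits not onto / thin / supported on simple or degenerate curves; avoidance of a fixed open set off the chord with probability `≥ p > 0`; `|γ_δ|` below the supercritical scale) are obstructed by NOTHING in the source or the catalogue: they hold at every `0 < x < x_c` in the forms proved in the tree (not weakly space-filling, `SupercriticalSAW.not_isSpaceFillingFamily_of_lt_criticalFugacity`; limits not onto and missing a fixed ball with positive probability, `SupercriticalSAW.not_ae_carrier_subset_range_subcritical_unitDisc`,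 `SupercriticalSAW.exists_ball_miss_of_subcritical_limit_unitDisc`; short, `SupercriticalSAW.tendsto_lawAt_length_lt_of_lt_criticalFugacity`), are expected there in the others (avoidance of a given set, simplicity: the geodesic picture [cite: DuminilCopinKozmaYadin2014, §1 (When x < 1/μ)]), and are expected at `x_c`, where they are what Problem 10 asks for [cite: DuminilCopinKozmaYadin2014, Problem 10]
- blocks: everything the base barrier blocks, unchanged; NOT blocked and recorded for planners as evasion (xii): LEFT-robust proofs of Problem-10-type conclusions, in particular the purely subcritical route to Problem 10 — `SupercriticalSAW.DKY2014_problem10_disk_of_leftUniform` (a left-uniform avoidance bound on `(x₀, x_c) × (0, δ₀)` gives `DKY2014_problem10_disk`), `SupercriticalSAW.not_isSpaceFillingFamily_criticalFugacity_of_leftUniform` (any endpoints in `𝔻_δ`), resting on `SupercriticalSAW.continuousOn_lawAt_apply` / `SupercriticalSAW.le_lawAt_criticalFugacity_of_left` (the law of a fixed event is continuous in `x` on `(0, ∞)` at fixed mesh, so left-uniform bounds pass to `x_c`); located transition: `SupercriticalSAW.isSpaceFillingFamily_iff_lt_of_ne` (for `x > 0`, `x ≠ x_c`, closest-site endpoints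 of boundary points `a ≠ b`: weakly space-filling ⇔ `x > x_c`), one-sided classes of the non-filling conclusion: RIGHT classes `[x_c, x_c + ε)` refuted (`SupercriticalSAW.not_forall_Ico_not_isSpaceFillingFamily`), LEFT-open classes `(x_c - ε, x_c)` theorems (`SupercriticalSAW.forall_Ioo_not_isSpaceFillingFamily`), the LEFT-closed class `(x_c - ε, x_c]` equivalent to the statement at `x_c` alone (`SupercriticalSAW.forall_Ioc_not_isSpaceFillingFamily_iff`), lattice-level left side `SupercriticalSAW.not_isSpaceFillingLaws_of_short` (any probability laws on SAWs of `𝔻_δ` with `|γ_δ| ≤ C/δ` w.h.p. are not weakly space-filling), limit-law left side `SupercriticalSAW.not_ae_carrier_subset_range_subcritical_unitDisc` / `SupercriticalSAW.exists_ball_miss_of_subcritical_limit_unitDisc` (for `0 < x < x_c` every limit in law of the SAW curves of the disc is not a.s. onto and misses a fixed ball `B(z, 2r)`, `B(z, r) ⊆ 𝔻`, with positive probability — the `hmiss` hypothesis of the core lemma of `…Proofs` holds on the whole subcritical half-line) [cite: DuminilCopinKozmaYadin2014, §1 (When x < 1/μ) and Problem 10]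
- because: a walk of `Ω_δ` through `M` vertices whose mesh points are pairwise `≥ d` apart has `δ|γ| ≥ (M-1) d` (order the visits; `t ↦ ⌊tδ/d⌋` is injective on the visit times), so a walk with `δ|γ_δ| ≤ C` misses one of the `(N+1)²` grid balls of radius `r/2` at spacing `2r = 1/(2(N+1))`, `N > 4C`, and the miss probabilities of finitely many balls cannot all tend to `0` while summing to `≥ P[|γ_δ| ≤ C/δ] → 1`; subcritical walks have `|γ_δ| ≤ C(x)/δ` w.h.p. because `cₙ xⁿ` is summable for `x < 1/μ` [cite: MadrasSlade1993, §1.2]; at fixed mesh `P_{(𝔻_δ,u,v,x)}(E) = Σ_{γ∈E} x^{|γ|} / Σ_γ x^{|γ|}` is a ratio of polynomials with positive denominator, continuous on `(0, ∞)` [cite: DuminilCopinKozmaYadin2014, §1 (definition of P_{(Ω_δ,a_δ,b_δ,x)})]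
- evasions_known: (i)–(xi) of the catalogue stand; NEW (xii): LEFT-robustness — the robustness classes of conclusions about the limit law near `x_c` are RIGHT-robust (conformal invariance / covariance, non-degeneracy, restriction covariance — true of the weights `x^{|γ|}` at every `x` — "SLE_κ for some `κ(x)`"; evasion (vii)), LEFT-robust (the Problem-10 family above), TWO-SIDED (tightness, subsequential limits, reversibility, domain Markov; gen 6) and `x_c`-ONLY (conjunctions such as "chordal SLE_{8/3}", pinned by `SupercriticalSAW.sawScalingLimitAt_iff_of_pos`); Lawler–Schramm–Werner's characterisation of SLE_{8/3} — the unique conformally invariant, restriction-covariant family supported on SIMPLE curves [cite: LawlerSchrammWerner2004SAW, §2.1 and Thm 1] — is a RIGHT-robust conjunct ∧ a LEFT-robust conjunct, so the barrier, which forbids `x`-robust proofs of the conjunction, permits ONE-SIDED `x`-robust proofs of each conjunct intersected at `x_c`; for the left conjunct the subcritical phase offers a finite correlation length, Ornstein–Zernike decay and the bridge / irreducible-bridge renewal structure at every `x < x_c` [cite: MadrasSlade1993, §4.1–4.2] [cite: BetzTaggi2019, §1], the work being uniformity as `x ↑ x_c` (crossover `δ ≍ ξ(x)⁻¹`) for a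 test set off the chord — the standard "from the subcritical side, uniformly" route of high-dimensional critical phenomena, realised for the SAW two-point function in `d ≥ 5` uniformly in `z ∈ [z_c - δ, z_c)` [cite: LiuSlade2026Crossover, §6.1 and Theorem 6.1]; for MONOTONE observables (length tails, stochastically increasing in `x`, `SupercriticalSAW.lawAt_setOf_lt_length_mono`) left-uniform bounds coincide with critical ones and nothing is gained
- scope_caveats: the lattice-level left side is for the unit disc with any endpoints in `𝔻_δ` (the length input `…SubcriticalLength` is stated there; the TSP lemmas are for arbitrary `Ω`); it shows that a short walk misses ONE of finitely many fixed balls, not avoidance of a GIVEN ball off the chord with probability `→ 1` (the geodesic picture [cite: DuminilCopinKozmaYadin2014, §1 (When x < 1/μ)], unproved in the tree); the left-uniform hypothesis of (b) is proved for no `U` — it is a reformulation of a quantitative Problem 10 for the disc, not a weakening, and is false for `U` meeting the chord `[a, b]` (subcritical walks follow it); fugacities `x ≤ 0` are junk for `lawAt`; whether avoidance probabilities are monotone in `x` (which would make the transfer automatic) is not known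
- status: established (proved in the tree: `SupercriticalSAWSpaceFillingLeftRobust_holds`, axioms `propext`, `Classical.choice`, `Quot.sound`); audit gen 7 of `…Proofs` 2026-08-16: CONFIRMED at page level [cite: DuminilCopinKozmaYadin2014, Theorem 1] [cite: DuminilCopinKozmaYadin2014, Problem 10] (27 citing works re-checked, none evading, Problem 10 unresolved in print) and NARROWED on the conclusion axis (left-robust class (xii))

[cite: DuminilCopinKozmaYadin2014, Theorem 1 and Problem 10] -/
def SupercriticalSAWSpaceFillingLeftRobust : Prop :=
  SupercriticalSAWSpaceFilling ∧
    (∀ x : ℝ, 0 < x → x < criticalFugacity → ∀ a b : ℂ, ∀ A B : ℝ → Site 2,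
      (∀ δ : ℝ, 0 < δ → IsClosestSite unitDisk δ a (A δ) ∧ IsClosestSite unitDisk δ b (B δ)) →
        ¬ IsSpaceFillingFamily x unitDisk A B) ∧
    ((∀ a b : ℂ, ‖a‖ = 1 → ‖b‖ = 1 → a ≠ b → ∀ A B : ℝ → Site 2,
      (∀ δ : ℝ, 0 < δ → IsClosestSite unitDisk δ a (A δ) ∧ IsClosestSite unitDisk δ b (B δ)) →
        ∃ U : Set ℂ, IsOpen U ∧ U ⊆ unitDisk ∧ U.Nonempty ∧ ∃ p : ℝ≥0∞, p ≠ 0 ∧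
          ∃ x₀ : ℝ, x₀ < criticalFugacity ∧ ∃ δ₀ : ℝ, 0 < δ₀ ∧
            ∀ δ ∈ Ioo 0 δ₀, ∀ x ∈ Ioo x₀ criticalFugacity,
              p ≤ lawAt x unitDisk δ (A δ) (B δ) {γ | ∀ v ∈ γ.walk.support, meshPoint δ v ∉ U}) →
      DKY2014_problem10_disk)

/-- **The audited barrier holds**: Theorem 1 is `SupercriticalSAWSpaceFilling_holds`
(`…TilesTheorem6`), clause (a) is `not_isSpaceFillingFamily_of_lt_criticalFugacity_closest`,
clause (b) is `DKY2014_problem10_disk_of_leftUniform`.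
[cite: DuminilCopinKozmaYadin2014, Theorem 1 and Problem 10] -/
theorem SupercriticalSAWSpaceFillingLeftRobust_holds : SupercriticalSAWSpaceFillingLeftRobust :=
  ⟨SupercriticalSAWSpaceFilling_holds,
    fun _ hx0 hxc _ _ _ _ hAB => not_isSpaceFillingFamily_of_lt_criticalFugacity_closest hx0 hxc hAB,
    DKY2014_problem10_disk_of_leftUniform⟩

end Literature.Barriers.CriticalPhenomena
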